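import Literature.MathematicalPhysics.QuantumFieldTheory.OSDistributionSpaceSemigroup
import Mathlib.MeasureTheory.Integral.IntervalIntegral.Basic
import HarnessLib

/-!
# The monotonicity bound for time averages of the OS semigroup, at the level of vectors

Osterwalder–Schrader II (Comm. Math. Phys. 42 (1975)), Ch. VI.1: bounds on `e^{-LH} v` that are
uniform in a time regularisation are obtained by comparing with *time averages*. The elementary
Hilbert-space fact behind this (a companion of `norm_shiftH_δ_le_norm_δ_average` in
`OSSemigroupAveraging`, which is phrased for OS vectors of test functions) is proved here for
**arbitrary vectors** of the OS Hilbert space: for a continuous weight `ρ ≥ 0` on `[0, L]` with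
`∫₀ᴸ ρ = 1`,

  `‖e^{-LH} v‖ ≤ ‖∫₀ᴸ ρ(s) e^{-sH} v ds‖`

(`norm_shiftH_le_norm_average`). Proof: with `A = ∫₀ᴸ ρ(s) e^{-sH} v ds`,
`Re ⟪e^{-LH} v, A⟫ = ∫₀ᴸ ρ(s) ‖e^{-((L+s)/2)H} v‖² ds ≥ ‖e^{-LH} v‖²` because the norms
`‖e^{-tH} v‖` decrease in `t` and `(L+s)/2 ≤ L`, while `Re ⟪e^{-LH} v, A⟫ ≤ ‖e^{-LH} v‖ ‖A‖`.

## References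

* K. Osterwalder, R. Schrader, *Axioms for Euclidean Green's functions II*, Comm. Math. Phys.
  42 (1975) 281–305, Ch. VI.1. [OsterwalderSchraderCMP1975]
-/

noncomputable section

open MeasureTheory Set Filter intervalIntegral
open _root_.Topology
open scoped InnerProductSpace NNReal ComplexConjugate

namespace Literature.MathematicalPhysics.QuantumFieldTheory

variable {d : ℕ} [NeZero d]

open Literature.MathematicalPhysics.QuantumLattice (SchwingerFamily)
open Literature.MathematicalPhysics.QuantumLattice.SchwingerFamily
open Literature.MathematicalPhysics.QuantumLattice.SchwingerFamily.OSSpace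

variable {𝔖 : SchwingerFamily (EuclideanSpace ℝ (Fin d))} {hE2 : 𝔖.IsOSReflectionPositive}

/-- **The norms `‖e^{-tH} v‖` decrease in `t ≥ 0`.** [folklore] -/
theorem norm_shiftH_apply_antitone (hE1 : 𝔖.IsEuclideanCovariant) (v : OSHilbert 𝔖 hE2) {s t : ℝ} (hs : 0 ≤ s) (hst : s ≤ t) :
    ‖shiftH hE2 t v‖ ≤ ‖shiftH hE2 s v‖ := by
  have h : shiftH hE2 t v = shiftH hE2 (t - s) (shiftH hE2 s v) := by
    rw [← shiftH_add_apply hE1 (by linarith) hs, sub_add_cancel]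
  rw [h]
  exact norm_shiftH_le hE1 _ _

/-- `⟪e^{-LH} v, e^{-sH} v⟫ = ‖e^{-((L+s)/2)H} v‖²` for `L, s ≥ 0`. [folklore] -/
theorem inner_shiftH_shiftH_self (hE1 : 𝔖.IsEuclideanCovariant) (v : OSHilbert 𝔖 hE2) {L s : ℝ} (hL : 0 ≤ L) (hs : 0 ≤ s) :
    ⟪shiftH hE2 L v, shiftH hE2 s v⟫_ℂ = ((‖shiftH hE2 ((L + s) / 2) v‖ ^ 2 : ℝ) : ℂ) := by
  rw [inner_shiftH_left hE1 hL, ← shiftH_add_apply hE1 hL hs, inner_shiftH_self_eq_norm_sq hE1 (by positivity)]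

/-- **The monotonicity bound for time averages (vector form)**: for `v` in the OS Hilbert space,
`L ≥ 0` and a continuous weight `ρ ≥ 0` on `[0, L]` with `∫₀ᴸ ρ = 1`,
`‖e^{-LH} v‖ ≤ ‖∫₀ᴸ ρ(s) e^{-sH} v ds‖`. [cite: OsterwalderSchraderCMP1975, Ch. VI.1] -/
theorem norm_shiftH_le_norm_average (hE1 : 𝔖.IsEuclideanCovariant) (v : OSHilbert 𝔖 hE2) {ρ : ℝ → ℝ} (hρ : Continuous ρ) {L : ℝ}
    (hL : 0 ≤ L) (hρ0 : ∀ s ∈ Icc 0 L, 0 ≤ ρ s) (hρ1 : ∫ s in 0..L, ρ s = 1) :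
    ‖shiftH hE2 L v‖ ≤ ‖∫ s in 0..L, (ρ s : ℂ) • shiftH hE2 s v‖ := by
  set A : OSHilbert 𝔖 hE2 := ∫ s in 0..L, (ρ s : ℂ) • shiftH hE2 s v with hA
  have hcont : Continuous fun s : ℝ => (ρ s : ℂ) • shiftH hE2 s v :=
    (Complex.continuous_ofReal.comp hρ).smul (continuous_shiftH_apply hE1 v)
  -- `Re ⟪e^{-LH} v, A⟫ ≥ ‖e^{-LH} v‖²`
  have hinner : ⟪shiftH hE2 L v, A⟫_ℂ = ∫ s in 0..L, (ρ s : ℂ) * ⟪shiftH hE2 L v, shiftH hE2 s v⟫_ℂ := by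
    rw [hA, intervalIntegral.integral_of_le hL, intervalIntegral.integral_of_le hL,
      ← integral_inner (hcont.integrableOn_Ioc)]
    refine integral_congr_ae (Eventually.of_forall fun s => ?_)
    beta_reduce
    rw [inner_smul_right]
  have hre : ‖shiftH hE2 L v‖ ^ 2 ≤ RCLike.re ⟪shiftH hE2 L v, A⟫_ℂ := by
    rw [hinner, intervalIntegral.integral_of_le hL]
    have hint : IntegrableOn (fun s : ℝ => (ρ s : ℂ) * ⟪shiftH hE2 L v, shiftH hE2 s v⟫_ℂ) (Ioc 0 L) :=
      ((Complex.continuous_ofReal.comp hρ).mul (continuous_const.inner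
        (continuous_shiftH_apply hE1 v))).integrableOn_Ioc
    have h1 : RCLike.re (∫ s in Ioc 0 L, (ρ s : ℂ) * ⟪shiftH hE2 L v, shiftH hE2 s v⟫_ℂ) =
        ∫ s in Ioc 0 L, ρ s * ‖shiftH hE2 ((L + s) / 2) v‖ ^ 2 := by
      rw [← integral_re hint]
      refine setIntegral_congr_fun measurableSet_Ioc fun s hs => ?_
      rw [inner_shiftH_shiftH_self hE1 v hL hs.1.le]
      simp only [RCLike.re_eq_complex_re, Complex.mul_re, Complex.ofReal_re, Complex.ofReal_im,
        zero_mul, sub_zero]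
    rw [h1]
    have h2 : ‖shiftH hE2 L v‖ ^ 2 = ∫ s in Ioc 0 L, ρ s * ‖shiftH hE2 L v‖ ^ 2 := by
      rw [MeasureTheory.integral_mul_const, ← intervalIntegral.integral_of_le hL, hρ1, one_mul]
    rw [h2]
    have hc2 : Continuous fun s : ℝ => ρ s * ‖shiftH hE2 ((L + s) / 2) v‖ ^ 2 :=
      hρ.mul (((continuous_shiftH_apply hE1 v).comp
        ((continuous_const.add continuous_id).div_const 2)).norm.pow 2)
    refine setIntegral_mono_on ((hρ.mul continuous_const).integrableOn_Ioc) hc2.integrableOn_Ioc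
      measurableSet_Ioc fun s hs => ?_
    exact mul_le_mul_of_nonneg_left (pow_le_pow_left₀ (norm_nonneg _)
      (norm_shiftH_apply_antitone hE1 v (s := (L + s) / 2) (t := L) (by linarith [hs.1])
        (by linarith [hs.2])) 2) (hρ0 s ⟨hs.1.le, hs.2⟩)
  -- conclude
  by_cases h0 : ‖shiftH hE2 L v‖ = 0
  · rw [h0]; exact norm_nonneg _
  · have hpos : 0 < ‖shiftH hE2 L v‖ := lt_of_le_of_ne (norm_nonneg _) (Ne.symm h0)
    have h3 : RCLike.re ⟪shiftH hE2 L v, A⟫_ℂ ≤ ‖shiftH hE2 L v‖ * ‖A‖ :=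
      (RCLike.re_le_norm _).trans (norm_inner_le_norm _ _)
    have h4 : ‖shiftH hE2 L v‖ * ‖shiftH hE2 L v‖ ≤ ‖shiftH hE2 L v‖ * ‖A‖ := by
      rw [← sq]; exact hre.trans h3
    exact le_of_mul_le_mul_left h4 hpos

end Literature.MathematicalPhysics.QuantumFieldTheory
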